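import Summits.CriticalPhenomena.SAWScalingLimit.Theorems.SAWTotalPositivityCriticalBubbleBoundKestenMSPolygon
import Summits.CriticalPhenomena.SAWScalingLimit.Theorems.SAWTotalPositivityCriticalBubbleBoundDockingDefs
import Summits.CriticalPhenomena.SAWScalingLimit.Theorems.SAWTotalPositivityCriticalBubbleBoundKestenCutBubbleBound
import HarnessLib

/-!
# Polynomial a-priori bounds for the ROOTED critical terms of `ℤ²` (line `kesten-product-renewal-dictionary`,
crux `SAWTotalPositivity.CriticalBubbleBound`, stmt-CriticalPhenomena-7117; lead c5, programme MS §8.1)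

The crux is `Σ_n t_n < ∞` for the rooted terms `t_n = c_n(0,e₀) x_c^n` (`Docking.term`,
`Negative.criticalBubbleBound_iff_bubble_e₀_ne_top`). From the landed Madras–Slade Corollary 8.1.5/8.1.6 for
`ℤ²` (`MS.ms_polygon_partialSum_le`: `Σ_{N ≤ M} q_N x_c^N ≤ 4√2 μ √(M+1)`) and the rooting identity
`Σ_{e ∼ 0} c_{2K-1}(0,e) = 2 · 2K · q_{2K}` (`Negative.sum_countAt_eq_mul_isotropicPolygonCount`) we derive the
first POLYNOMIAL a-priori bounds on the crux's terms (the tree's previous window was the Hammersley–Welsh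
stretched exponential `t_n ≤ e^{κ√n}`, `Negative.hw_term_upper_bound`):

* `ms_countAt_le` — `c_n(0,e₀) ≤ 2(n+1) q_{n+1}` (`n ≥ 2`);
* `ms_term_le` — `t_n ≤ 8√2 μ² (n+1) √(n+2)`, i.e. `t_n = O(n^{3/2})` TERMWISE (weaker than what Hammersley's
  classical `q_N ≤ μ^N` would give, `O(n)`, but the tree has neither; conjecturally `t_n ≍ n^{-3/2}`);
* `ms_blockMass_term_le` — the dyadic blocks of the docking ledger satisfy `R_i = Σ_{n ∈ [2^i,2^{i+1})} t_n ≤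
  16√2 μ² 2^i √(2^{i+1}+1)`, i.e. `R_i = O(2^{3i/2})` — the AVERAGED exponent ("`θ ≥ 1/2` on dyadic blocks";
  termwise bounds alone would give `O(2^{2i})`), a polynomial a-priori input for `Docking.stub_ledgerBootstrap`
  in place of Hammersley–Welsh (the crux is `Σ_i R_i < ∞`).

Source: N. Madras, G. Slade, *The Self-Avoiding Walk* (1993), §8.1 (Cor. 8.1.5–8.1.6, eq. (8.1.2)).
-/

noncomputable section

open Literature.Probability.LatticeModels
open Literature.Probability.RandomPlanarGeometry Literature.Probability.RandomPlanarGeometry.SAW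
open Summit.CriticalPhenomena.SAWScalingLimit.Theorems.CriticalBubbleBound.Negative
open Summit.CriticalPhenomena.SAWScalingLimit.Theorems.CriticalBubbleBound.Docking
open Literature.Barriers.CriticalPhenomena (isotropicPolygonCount)
open scoped BigOperators
open Classical

namespace Summit.CriticalPhenomena.SAWScalingLimit.Theorems.CriticalBubbleBound.Kesten.MS

/-- **Rooting**: `c_n(0,e₀) ≤ 2(n+1) q_{n+1}` for `n ≥ 2` (for even `n` the left side vanishes; for odd
`n = 2K - 1` it is one of the four equal terms of `Σ_{e∼0} c_{2K-1}(0,e) = 2·2K·q_{2K}`).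
[cite: MadrasSlade1993, §8.1, eq. (8.1.2)] -/
theorem ms_countAt_le {n : ℕ} (hn : 2 ≤ n) :
    Zd.countAt 2 n e₀ ≤ 2 * (n + 1) * isotropicPolygonCount (n + 1) := by
  rcases Nat.even_or_odd n with he | ho
  · rw [countAt_eq_zero_of_even_of_adj he adj_zero_e₀]; exact Nat.zero_le _
  · obtain ⟨k, rfl⟩ := ho
    -- `n = 2k+1 = 2K-1` with `K = k+1 ≥ 2`
    have hK : 2 ≤ k + 1 := by omega
    have hsum := sum_countAt_eq_mul_isotropicPolygonCount (k + 1) hK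
    have h1 : 2 * (k + 1) - 1 = 2 * k + 1 := by omega
    rw [h1] at hsum
    have hmem : e₀ ∈ (zdGraph 2).neighborFinset 0 := by
      rw [SimpleGraph.mem_neighborFinset]; exact adj_zero_e₀
    calc Zd.countAt 2 (2 * k + 1) e₀
        ≤ ∑ e ∈ (zdGraph 2).neighborFinset 0, Zd.countAt 2 (2 * k + 1) e :=
          Finset.single_le_sum (fun e _ => Nat.zero_le _) hmem
      _ = 2 * (2 * (k + 1)) * isotropicPolygonCount (2 * (k + 1)) := hsum
      _ = 2 * (2 * k + 1 + 1) * isotropicPolygonCount (2 * k + 1 + 1) := by ring_nf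

/-- **Rooted terms are `O(n^{3/2})`** (termwise): `t_n = c_n(0,e₀) x_c^n ≤ 8√2 μ² (n+1) √(n+2)` for every `n`.
[cite: MadrasSlade1993, Corollary 8.1.6] -/
theorem ms_term_le (n : ℕ) :
    term n ≤ 8 * Real.sqrt 2 * connectiveConstant ^ 2 * (((n : ℝ) + 1) * Real.sqrt ((n : ℝ) + 2)) := by
  have hx := StripMass.criticalFugacity_pos
  have hμ1 : 1 ≤ connectiveConstant := by
    rw [show connectiveConstant = criticalFugacity⁻¹ by rw [criticalFugacity, inv_inv]]
    exact (one_le_inv₀ criticalFugacity_pos_lt_one'.1).2 criticalFugacity_pos_lt_one'.2.le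
  have hμ : 0 < connectiveConstant := by linarith
  have hs1 : 1 ≤ Real.sqrt ((n : ℝ) + 2) := by
    rw [← Real.sqrt_one]
    exact Real.sqrt_le_sqrt (by linarith [(n.cast_nonneg : (0 : ℝ) ≤ n)])
  have hs2 : 1 ≤ Real.sqrt 2 := by
    rw [← Real.sqrt_one]
    exact Real.sqrt_le_sqrt (by norm_num)
  rcases lt_or_ge n 2 with hn | hn
  · -- `n = 0`: the term vanishes; `n = 1`: the term is `x_c ≤ 1`
    have hsmall : term n ≤ 1 := by
      interval_cases n
      · simp [term, Cut.countAt_zero_e₀]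
      · rw [term, countAt_one_of_adj adj_zero_e₀, Nat.cast_one, one_mul, pow_one, criticalFugacity]
        exact inv_le_one_of_one_le₀ hμ1
    refine hsmall.trans ?_
    have h8 : (1 : ℝ) ≤ 8 * Real.sqrt 2 * connectiveConstant ^ 2 := by nlinarith
    have hn1 : (1 : ℝ) ≤ (n : ℝ) + 1 := by linarith [(n.cast_nonneg : (0 : ℝ) ≤ n)]
    calc (1 : ℝ) = 1 * (1 * 1) := by ring
      _ ≤ 8 * Real.sqrt 2 * connectiveConstant ^ 2 * (((n : ℝ) + 1) * Real.sqrt ((n : ℝ) + 2)) :=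
          mul_le_mul h8 (mul_le_mul hn1 hs1 zero_le_one (by positivity)) (by norm_num) (by positivity)
  · -- `n ≥ 2`: root the polygon and use the partial-sum bound at `M = n+1`
    have h1 : (Zd.countAt 2 n e₀ : ℝ) ≤ 2 * ((n : ℝ) + 1) * (isotropicPolygonCount (n + 1) : ℝ) := by
      exact_mod_cast ms_countAt_le hn
    have h2 : (isotropicPolygonCount (n + 1) : ℝ) * criticalFugacity ^ (n + 1) ≤
        4 * Real.sqrt 2 * connectiveConstant * Real.sqrt (((n + 1 : ℕ) : ℝ) + 1) := ms_polygon_term_le (n + 1)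
    have h2' : (isotropicPolygonCount (n + 1) : ℝ) * criticalFugacity ^ (n + 1) ≤
        4 * Real.sqrt 2 * connectiveConstant * Real.sqrt ((n : ℝ) + 2) := by
      convert h2 using 3; push_cast; ring
    have hxμ : criticalFugacity * connectiveConstant = 1 := by
      rw [criticalFugacity, inv_mul_cancel₀ hμ.ne']
    calc term n = (Zd.countAt 2 n e₀ : ℝ) * criticalFugacity ^ n := rfl
      _ ≤ 2 * ((n : ℝ) + 1) * (isotropicPolygonCount (n + 1) : ℝ) * criticalFugacity ^ n := by
          gcongr
      _ = 2 * ((n : ℝ) + 1) * connectiveConstant *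
            ((isotropicPolygonCount (n + 1) : ℝ) * criticalFugacity ^ (n + 1)) := by
          rw [pow_succ]
          linear_combination (-(2 * ((n : ℝ) + 1) * (isotropicPolygonCount (n + 1) : ℝ) *
            criticalFugacity ^ n)) * hxμ
      _ ≤ 2 * ((n : ℝ) + 1) * connectiveConstant * (4 * Real.sqrt 2 * connectiveConstant * Real.sqrt ((n : ℝ) + 2)) := by
          gcongr
      _ = _ := by ring

/-- **Dyadic blocks are `O(2^{3i/2})`** (the averaged exponent `θ ≥ 1/2`): `R_i = Σ_{n ∈ [2^i, 2^{i+1})} t_n ≤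
16√2 μ² · 2^i · √(2^{i+1} + 1)` — a polynomial a-priori bound for the docking ledger (`Docking.stub_ledgerBootstrap`
was fed the Hammersley–Welsh stretched exponential). [cite: MadrasSlade1993, Corollary 8.1.6] -/
theorem ms_blockMass_term_le : ∀ i : ℕ, blockMass term i ≤ 16 * Real.sqrt 2 * connectiveConstant ^ 2 * (2 ^ i * Real.sqrt (2 ^ (i + 1) + 1)) := by
  intro i
  have hx := StripMass.criticalFugacity_pos
  have hμ1 : 1 ≤ connectiveConstant := by
    rw [show connectiveConstant = criticalFugacity⁻¹ by rw [criticalFugacity, inv_inv]]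
    exact (one_le_inv₀ criticalFugacity_pos_lt_one'.1).2 criticalFugacity_pos_lt_one'.2.le
  have hμ : 0 < connectiveConstant := by linarith
  have hxμ : criticalFugacity * connectiveConstant = 1 := by
    rw [criticalFugacity, inv_mul_cancel₀ hμ.ne']
  have hi : 2 ≤ 2 ^ i ∨ i = 0 := by
    rcases Nat.eq_zero_or_pos i with rfl | hi
    · exact Or.inr rfl
    · exact Or.inl (by calc 2 = 2 ^ 1 := by norm_num
        _ ≤ 2 ^ i := Nat.pow_le_pow_right (by norm_num) hi)
  rcases hi with hi | rfl
  · -- every `n` in the block is `≥ 2`: root and regroup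
    have step : ∀ n ∈ block i, term n ≤ 2 * (2 : ℝ) ^ (i + 1) * connectiveConstant *
        ((isotropicPolygonCount (n + 1) : ℝ) * criticalFugacity ^ (n + 1)) := by
      intro n hn
      rw [block, Finset.mem_Ico] at hn
      have hn2 : 2 ≤ n := hi.trans hn.1
      have h1 : (Zd.countAt 2 n e₀ : ℝ) ≤ 2 * ((n : ℝ) + 1) * (isotropicPolygonCount (n + 1) : ℝ) := by
        exact_mod_cast ms_countAt_le hn2
      have hn' : (n : ℝ) + 1 ≤ (2 : ℝ) ^ (i + 1) := by exact_mod_cast hn.2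
      calc term n = (Zd.countAt 2 n e₀ : ℝ) * criticalFugacity ^ n := rfl
        _ ≤ 2 * ((n : ℝ) + 1) * (isotropicPolygonCount (n + 1) : ℝ) * criticalFugacity ^ n := by gcongr
        _ = 2 * ((n : ℝ) + 1) * connectiveConstant *
              ((isotropicPolygonCount (n + 1) : ℝ) * criticalFugacity ^ (n + 1)) := by
            rw [pow_succ]
            linear_combination (-(2 * ((n : ℝ) + 1) * (isotropicPolygonCount (n + 1) : ℝ) *
              criticalFugacity ^ n)) * hxμ
        _ ≤ 2 * (2 : ℝ) ^ (i + 1) * connectiveConstant *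
              ((isotropicPolygonCount (n + 1) : ℝ) * criticalFugacity ^ (n + 1)) := by
            gcongr
    -- sum over the block and compare with the partial sum up to `2^{i+1}`
    have hsum : ∑ n ∈ block i, (isotropicPolygonCount (n + 1) : ℝ) * criticalFugacity ^ (n + 1) ≤
        ∑ N ∈ Finset.range (2 ^ (i + 1) + 1), (isotropicPolygonCount N : ℝ) * criticalFugacity ^ N := by
      rw [block]
      calc ∑ n ∈ Finset.Ico (2 ^ i) (2 ^ (i + 1)), (isotropicPolygonCount (n + 1) : ℝ) * criticalFugacity ^ (n + 1)
          = ∑ N ∈ (Finset.Ico (2 ^ i) (2 ^ (i + 1))).image (· + 1),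
              (isotropicPolygonCount N : ℝ) * criticalFugacity ^ N := by
            rw [Finset.sum_image fun a _ b _ h => by simpa using h]
        _ ≤ _ := by
            refine Finset.sum_le_sum_of_subset_of_nonneg ?_ fun N _ _ => by positivity
            intro N hN
            rw [Finset.mem_image] at hN
            obtain ⟨a, ha, rfl⟩ := hN
            rw [Finset.mem_Ico] at ha
            rw [Finset.mem_range]
            omega
    have hps := ms_polygon_partialSum_le (2 ^ (i + 1))
    calc blockMass term i = ∑ n ∈ block i, term n := rfl
      _ ≤ ∑ n ∈ block i, 2 * (2 : ℝ) ^ (i + 1) * connectiveConstant *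
            ((isotropicPolygonCount (n + 1) : ℝ) * criticalFugacity ^ (n + 1)) := Finset.sum_le_sum step
      _ = 2 * (2 : ℝ) ^ (i + 1) * connectiveConstant *
            ∑ n ∈ block i, (isotropicPolygonCount (n + 1) : ℝ) * criticalFugacity ^ (n + 1) := by
          rw [Finset.mul_sum]
      _ ≤ 2 * (2 : ℝ) ^ (i + 1) * connectiveConstant *
            (4 * Real.sqrt 2 * connectiveConstant * Real.sqrt (((2 ^ (i + 1) : ℕ) : ℝ) + 1)) := by
          gcongr; exact hsum.trans hps
      _ = 16 * Real.sqrt 2 * connectiveConstant ^ 2 * (2 ^ i * Real.sqrt (2 ^ (i + 1) + 1)) := by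
          push_cast; ring
  · -- `i = 0`: the block is `{1}` and `t_1 = x_c ≤ 1`
    have hb : blockMass term 0 = term 1 := by
      rw [blockMass, block]; simp
    rw [hb, term, countAt_one_of_adj adj_zero_e₀, Nat.cast_one, one_mul, pow_one]
    have hxc : criticalFugacity ≤ 1 := by rw [criticalFugacity]; exact inv_le_one_of_one_le₀ hμ1
    have hs : 1 ≤ Real.sqrt (2 ^ (0 + 1) + 1) := by
      rw [← Real.sqrt_one]
      exact Real.sqrt_le_sqrt (by norm_num)
    have hs2 : 1 ≤ Real.sqrt 2 := by
      rw [← Real.sqrt_one]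
      exact Real.sqrt_le_sqrt (by norm_num)
    calc criticalFugacity ≤ 1 := hxc
      _ = 1 * 1 * (1 * 1) := by ring
      _ ≤ 16 * Real.sqrt 2 * connectiveConstant ^ 2 * (2 ^ 0 * Real.sqrt (2 ^ (0 + 1) + 1)) := by
          gcongr <;> nlinarith

/-- **Partial sums of the crux's rooted series are `O(M^{3/2})`**: `Σ_{n ≤ M} t_n ≤ 1 + 8√2 μ² (M+1) √(M+2)`
(the crux `CriticalBubbleBound` ⟺ `Σ_n t_n < ∞`, `Negative.criticalBubbleBound_iff_bubble_e₀_ne_top`; the proved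
window so far had only the stretched-exponential termwise bound). [cite: MadrasSlade1993, Corollary 8.1.6] -/
theorem ms_term_partialSum_le (M : ℕ) :
    ∑ n ∈ Finset.range (M + 1), term n ≤
      1 + 8 * Real.sqrt 2 * connectiveConstant ^ 2 * (((M : ℝ) + 1) * Real.sqrt ((M : ℝ) + 2)) := by
  have hx := StripMass.criticalFugacity_pos
  have hμ1 : 1 ≤ connectiveConstant := by
    rw [show connectiveConstant = criticalFugacity⁻¹ by rw [criticalFugacity, inv_inv]]
    exact (one_le_inv₀ criticalFugacity_pos_lt_one'.1).2 criticalFugacity_pos_lt_one'.2.le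
  have hμ : 0 < connectiveConstant := by linarith
  have hxμ : criticalFugacity * connectiveConstant = 1 := by
    rw [criticalFugacity, inv_mul_cancel₀ hμ.ne']
  -- split off `n = 0, 1` (total `≤ 1`) and root the rest
  have hsplit : ∑ n ∈ Finset.range (M + 1), term n =
      ∑ n ∈ (Finset.range (M + 1)).filter (· < 2), term n +
        ∑ n ∈ (Finset.range (M + 1)).filter (fun n => ¬ n < 2), term n :=
    (Finset.sum_filter_add_sum_filter_not _ _ _).symm
  have hsmall : ∑ n ∈ (Finset.range (M + 1)).filter (· < 2), term n ≤ 1 := by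
    have hsub : (Finset.range (M + 1)).filter (· < 2) ⊆ {0, 1} := by
      intro n hn
      rw [Finset.mem_filter] at hn
      rw [Finset.mem_insert, Finset.mem_singleton]
      omega
    calc ∑ n ∈ (Finset.range (M + 1)).filter (· < 2), term n
        ≤ ∑ n ∈ ({0, 1} : Finset ℕ), term n :=
          Finset.sum_le_sum_of_subset_of_nonneg hsub fun n _ _ => term_nonneg n
      _ = term 0 + term 1 := by rw [Finset.sum_pair (by norm_num)]
      _ ≤ 0 + 1 := by
          gcongr
          · simp [term, Cut.countAt_zero_e₀]
          · rw [term, countAt_one_of_adj adj_zero_e₀, Nat.cast_one, one_mul, pow_one, criticalFugacity]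
            exact inv_le_one_of_one_le₀ hμ1
      _ = 1 := by ring
  have hbig : ∑ n ∈ (Finset.range (M + 1)).filter (fun n => ¬ n < 2), term n ≤
      8 * Real.sqrt 2 * connectiveConstant ^ 2 * (((M : ℝ) + 1) * Real.sqrt ((M : ℝ) + 2)) := by
    have step : ∀ n ∈ (Finset.range (M + 1)).filter (fun n => ¬ n < 2), term n ≤
        2 * ((M : ℝ) + 1) * connectiveConstant *
          ((isotropicPolygonCount (n + 1) : ℝ) * criticalFugacity ^ (n + 1)) := by
      intro n hn
      rw [Finset.mem_filter, Finset.mem_range] at hn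
      have hn2 : 2 ≤ n := by omega
      have h1 : (Zd.countAt 2 n e₀ : ℝ) ≤ 2 * ((n : ℝ) + 1) * (isotropicPolygonCount (n + 1) : ℝ) := by
        exact_mod_cast ms_countAt_le hn2
      have hn' : (n : ℝ) + 1 ≤ (M : ℝ) + 1 := by exact_mod_cast (by omega : n + 1 ≤ M + 1)
      calc term n = (Zd.countAt 2 n e₀ : ℝ) * criticalFugacity ^ n := rfl
        _ ≤ 2 * ((n : ℝ) + 1) * (isotropicPolygonCount (n + 1) : ℝ) * criticalFugacity ^ n := by gcongr
        _ = 2 * ((n : ℝ) + 1) * connectiveConstant *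
              ((isotropicPolygonCount (n + 1) : ℝ) * criticalFugacity ^ (n + 1)) := by
            rw [pow_succ]
            linear_combination (-(2 * ((n : ℝ) + 1) * (isotropicPolygonCount (n + 1) : ℝ) *
              criticalFugacity ^ n)) * hxμ
        _ ≤ 2 * ((M : ℝ) + 1) * connectiveConstant *
              ((isotropicPolygonCount (n + 1) : ℝ) * criticalFugacity ^ (n + 1)) := by
            gcongr
    have hsum : ∑ n ∈ (Finset.range (M + 1)).filter (fun n => ¬ n < 2),
        (isotropicPolygonCount (n + 1) : ℝ) * criticalFugacity ^ (n + 1) ≤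
        ∑ N ∈ Finset.range (M + 1 + 1), (isotropicPolygonCount N : ℝ) * criticalFugacity ^ N := by
      calc ∑ n ∈ (Finset.range (M + 1)).filter (fun n => ¬ n < 2),
            (isotropicPolygonCount (n + 1) : ℝ) * criticalFugacity ^ (n + 1)
          = ∑ N ∈ ((Finset.range (M + 1)).filter (fun n => ¬ n < 2)).image (· + 1),
              (isotropicPolygonCount N : ℝ) * criticalFugacity ^ N := by
            rw [Finset.sum_image fun a _ b _ h => by simpa using h]
        _ ≤ _ := by
            refine Finset.sum_le_sum_of_subset_of_nonneg ?_ fun N _ _ => by positivity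
            intro N hN
            rw [Finset.mem_image] at hN
            obtain ⟨a, ha, rfl⟩ := hN
            rw [Finset.mem_filter, Finset.mem_range] at ha
            rw [Finset.mem_range]
            omega
    have hps := ms_polygon_partialSum_le (M + 1)
    have hps' : ∑ N ∈ Finset.range (M + 1 + 1), (isotropicPolygonCount N : ℝ) * criticalFugacity ^ N ≤
        4 * Real.sqrt 2 * connectiveConstant * Real.sqrt ((M : ℝ) + 2) := by
      convert hps using 3; push_cast; ring
    calc ∑ n ∈ (Finset.range (M + 1)).filter (fun n => ¬ n < 2), term n
        ≤ ∑ n ∈ (Finset.range (M + 1)).filter (fun n => ¬ n < 2), 2 * ((M : ℝ) + 1) * connectiveConstant *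
            ((isotropicPolygonCount (n + 1) : ℝ) * criticalFugacity ^ (n + 1)) := Finset.sum_le_sum step
      _ = 2 * ((M : ℝ) + 1) * connectiveConstant * ∑ n ∈ (Finset.range (M + 1)).filter (fun n => ¬ n < 2),
            (isotropicPolygonCount (n + 1) : ℝ) * criticalFugacity ^ (n + 1) := by rw [Finset.mul_sum]
      _ ≤ 2 * ((M : ℝ) + 1) * connectiveConstant * (4 * Real.sqrt 2 * connectiveConstant * Real.sqrt ((M : ℝ) + 2)) := by
          gcongr; exact hsum.trans hps'
      _ = _ := by ring
  rw [hsplit]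
  linarith

end Summit.CriticalPhenomena.SAWScalingLimit.Theorems.CriticalBubbleBound.Kesten.MS

end
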